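import Summits.QuantumFields.BalabanUV.Beta.GAN24.ChargeTowerStep
import Summits.QuantumFields.BalabanUV.Beta.KernelLegPullback

/-!
# `BalabanUV.Beta.GAN24.QuarticPushCoordCharge` — binder row G-an2-4 ∕ (CONV-C), row (C) at the levels `j ≥ 1`, CONTACT side; Part 23 of
# `GAN24/FourFaceGaugeSectors`: **THE ORDER-2 TOWER STEP — SINGLE-COORDINATE CHARGE FUNCTIONS OF THE CO-DRESSED QUARTIC PUSH** — road-P2 g41's
# `ChargeTowerStep.hasSum_prod_coordWeighted_e3OfK_inl_inl` with the vertex replaced by ANY localised interior `V`, and its instance for the second bond-derivative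
# read-out `mmRead Lc (K3OfK G_j …)` (= `e4OfKW`, the E-sector of `T2RecAt (j+1)` up to its weight): for every bounded `f₁ f₂ : ℤ → ℝ`,
# `Σ'_{(x′,z′)} f₁(x′_α)·f₂(z′_β)·(G_j∘V∘G_j)(Lc•x′, Lc•z′)(inr α, inr β) = −cH_j²·Σ'_{(y,w)} 𝟙[y_α % Lc = Lc−1 ∧ w_β % Lc = Lc−1]·f₁((blk y)_α)·f₂((blk w)_β)·V y w (inl α)(inl β)`

NOT IN PRINT; OUR BOOKKEEPING (G-an2-4 crux team (2), leaf prover `b2b-balaban-gan24-formalise-leaf-02`, gen 66).  WHY.  Part 1 (`FourFaceGaugeSectors`) writes the four-face excess of a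
table as the signed sum of its pure-gauge SECTORS `Sector_S(Y) = Σ_{r∈cell} Σ'_{u′xz} (Π_{s∈S} φ(slot_s (δ_s)))·Y κ r κ′ u′ x z (inl α)(inl β)` with the SINGLE-COORDINATE weight
`φ(m) = 1 − Lc·[m % Lc = Lc−1]` read on each weighted slot's OWN direction; so the kernel legs of every sector of `T2RecAt (j+1) = (cE₂·wV4)•mmRead Lc (K3OfK G_j …) + border` carry
weights `f₁(x_α)`, `f₂(z_β)` with `f ∈ {1, φ}` — EXACTLY the currency of road-P2's (γ) charge tower (`ChargeTowerStep`: the classes `{1, exit^{Lc}, exit^{Lc²}, …}` all pull back to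
one class).  The cubic step there used of the vertex only its bi-localisation; THIS FILE is the same step for a generic `Loc V`, hence for the order-2 interior
`Y = dM_b G_j dM_{b′} + dM_{b′} G_j dM_b − W_{bb′}` (an2's `KernelLegPullback.K3OfK_eq_sandwich`): the level-(j+1) kernel legs land on the EXIT FACES of the level-`j` blocks, on the
interior's FIELD–FIELD entries `(inl α, inl β)` only, with the block-constant pull-backs `f_i((blk ·)_·)` — the entrance of the order-2 leg tower in its native currency (memo
`HOME/…/leaf-02/g66/CT-VALUES-PLAN-v0.md` §5–§6; Parts 21–22 are the `n ⊗ dφ` twin and the interior's two-column letters).  The interior's own letters are NOT touched.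

WHAT (every `j`, in-block root `ρ = toSite r`, `G_j = coDressKBmAt ρ Lc (KInvStep Lc j)`, `cH_j = (stepScale_j·Lc^{d+1})⁻¹`, bounded `f₁ f₂ : ℤ → ℝ`; [folklore] Fubini ∕ Ward bookkeeping
BY NAME over road-P2's `ChargeTowerLegs.hasSum_sandwich_readout_two ∕ hasSum_row_coord_inl ∕ _inr ∕ hasSum_col_coord_inl ∕ _inr`, `ChargeTowerStep.comp_comp_weighted ∕ sum_sum_coord_kron`;
0 `def`, 0 cited facts, 0 `def … : Prop`, 0 sorry):
* **`hasSum_prod_coordWeighted_sandwich`** — ANY `Loc V`: `HasSum ((x′,z′) ↦ f₁(x′_α)·f₂(z′_β)·(G_j∘V∘G_j)(Lc•x′, Lc•z′)(inr α, inr β))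
  (−(cH_j²·Σ'_{(y,w)} 𝟙[y_α % Lc = Lc−1 ∧ w_β % Lc = Lc−1]·f₁((blk y)_α)·f₂((blk w)_β)·V y w (inl α)(inl β)))`.
* **`hasSum_prod_coordWeighted_K3OfK_inl_inl`** — the same for `mmRead Lc (K3OfK G_j Lc S M W b b′) x′ z′ (inl α)(inl β)` under the letter's `Loc (dM_b)`, `Loc (dM_{b′})`, `Loc (W_{bb′})`
  verbatim, `V := dM_b∘G_j∘dM_{b′} + dM_{b′}∘G_j∘dM_b − W_{bb′}` (the SIGN: `e3OfK = −mmRead(G V G)` carries a minus the quartic read-out does not).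
HONEST FRAMING (cell contract, verbatim): «discharging `BetaPertH` makes Bałaban's UV stability UNCONDITIONAL — a real constructive-QFT result; it is NOT the continuum limit and
NOT the Clay problem.»  HONEST DEPENDENCY (verbatim): «continuum YM on T⁴ ⇐ BetaPertH ∧ nine spine estimates (0/9 proved); BetaPertH ⇐ (D1) ∧ (D4) ∧ CAP+tail; G-an2-4
gates asym, D1 and NE2/3/4.»  Asserts NO value of any resolvent column beyond road-P2 g41's four weighted coarse-leg charges (d1-leaf-07's ∕ an1's column laws); NOTHING of (C) at
j ≥ 1 ∕ (C)sym ∕ (Q-L) ∕ «T2Shape» ∕ «T2Drift» ∕ (hW, hWall) discharged; NEVER «G-an2-4 closed» as (CONV-C); NOT D1, NOT `BetaPertH`, NOT continuum, NOT Clay.  2026-08-23; the proof of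
§1 is ADAPTED from road-P2's `ChargeTowerStep.hasSum_prod_coordWeighted_e3OfK_inl_inl` (said so); no existing file touched.
-/

noncomputable section

open Finset
open scoped BigOperators
open Literature.MathematicalPhysics.QuantumFieldTheory
open Literature.MathematicalPhysics.QuantumFieldTheory.Balaban1983to89
open Literature.MathematicalPhysics.QuantumFieldTheory.Balaban1983to89.Beta
open ExpKernelCalculus (Site MKer BiLoc Decays comp)
open OneStepResolventKernel (Fib)
open AffineAveraging (box toSite)
open AveragingContours (blk)
open AxialProjector (blk_zsmul)
open OneStepKernelFamily (KInvStep decays_KInvStep)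
open SecondOrderResponse (dM)
open BalabanStepW2 (K3OfK)
open BalabanStepJetsSucc (mmRead mmRead_inl_inl)
open Summit.QuantumFields.BalabanUV.Beta.TameKernelCalculus
open Summit.QuantumFields.BalabanUV.Beta.AxialDressingRooted (coDressKBmAt decays_coDressKBmAt one_le_of_neZero spr_coDressKBmAt)
open Summit.QuantumFields.BalabanUV.Beta.BorderedHessian (stepScale spr_KInvStep)
open Summit.QuantumFields.BalabanUV.Beta.KernelLegPullback (K3OfK_eq_sandwich)
open Summit.QuantumFields.BalabanUV.Beta.GAN24.ChargeTowerLegs (hasSum_sandwich_readout_two hasSum_row_coord_inl hasSum_row_coord_inr hasSum_col_coord_inl hasSum_col_coord_inr)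
open Summit.QuantumFields.BalabanUV.Beta.GAN24.ChargeTowerStep (comp_comp_weighted sum_sum_coord_kron)

namespace Summit.QuantumFields.BalabanUV.Beta.GAN24.QuarticPushCoordCharge

variable {d : ℕ} {Lc : ℕ} [NeZero Lc] {r : Fin (d + 1) → ℕ}

/-! ## §1 The order-2 tower step for a generic localised interior -/

/-- NOT IN PRINT; OUR BOOKKEEPING.  **THE TOWER STEP FOR A CO-DRESSED SANDWICH `G_j ∘ V ∘ G_j`** (every `j`, in-block root `ρ = toSite r`, ANY localised `V`, bounded `f₁ f₂ : ℤ → ℝ`;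
`G_j = coDressKBmAt ρ Lc (KInvStep Lc j)`, `cH_j = (stepScale_j·Lc^{d+1})⁻¹`):
`HasSum ((x′,z′) ↦ f₁(x′_α)·f₂(z′_β)·(G_j∘V∘G_j)(Lc•x′, Lc•z′)(inr α, inr β))
   (−(cH_j²·Σ'_{(y,w)} 𝟙[y_α % Lc = Lc−1 ∧ w_β % Lc = Lc−1]·f₁((blk y)_α)·f₂((blk w)_β)·V y w (inl α)(inl β)))`
— the coarse multiplier legs against single-coordinate weights are the EXIT-SUPPORTED block-constant pull-backs on the interior's field legs, same direction, same fibre index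
(road-P2's four weighted coarse-leg charges), nothing on its multiplier legs. -/
theorem hasSum_prod_coordWeighted_sandwich (hr : r ∈ box (d + 1) Lc) (j : ℕ) {V : MKer (d + 1) (Fib d)} (hV : Loc V)
    (α β : Fin (d + 1)) (f₁ f₂ : ℤ → ℝ) {B₁ B₂ : ℝ} (hf₁ : ∀ s, |f₁ s| ≤ B₁) (hf₂ : ∀ s, |f₂ s| ≤ B₂) :
    HasSum (fun xz : Site (d + 1) × Site (d + 1) => f₁ (xz.1 α) * f₂ (xz.2 β) *
        comp (comp (coDressKBmAt (toSite r) Lc (KInvStep (d := d) Lc j)) V) (coDressKBmAt (toSite r) Lc (KInvStep (d := d) Lc j))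
          ((Lc : ℤ) • xz.1) ((Lc : ℤ) • xz.2) (Sum.inr α) (Sum.inr β))
      (-((stepScale d Lc j * (Lc : ℝ) ^ (d + 1))⁻¹ ^ 2 *
        ∑' yw : Site (d + 1) × Site (d + 1),
          (if yw.1 α % (Lc : ℤ) = (Lc : ℤ) - 1 ∧ yw.2 β % (Lc : ℤ) = (Lc : ℤ) - 1 then
            f₁ (blk Lc yw.1 α) * f₂ (blk Lc yw.2 β) * V yw.1 yw.2 (Sum.inl α) (Sum.inl β) else 0))) := by
  classical
  have hLc : 1 ≤ Lc := Nat.one_le_iff_ne_zero.2 (NeZero.ne Lc)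
  set G : MKer (d + 1) (Fib d) := coDressKBmAt (toSite r) Lc (KInvStep (d := d) Lc j) with hGdef
  obtain ⟨δ, C, hδ, -, hK⟩ := decays_KInvStep (d := d) (Lc := Lc) j
  obtain ⟨δG, CG, hδG, hCG, hG⟩ := decays_coDressKBmAt hLc hr (K := KInvStep (d := d) Lc j) ⟨δ, C, hδ, hK.nonneg (Sum.inl 0), hK⟩
  obtain ⟨p, q, Cv, δv, hδv, hVb⟩ := hV
  have hB₁ : 0 ≤ B₁ := (abs_nonneg _).trans (hf₁ 0)
  have hB₂ : 0 ≤ B₂ := (abs_nonneg _).trans (hf₂ 0)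
  -- the two weighted kernels
  set K₁ : MKer (d + 1) (Fib d) := fun p' q' e f => f₁ (blk Lc p' α) * G p' q' e f with hK₁def
  set K₂ : MKer (d + 1) (Fib d) := fun p' q' e f => G p' q' e f * f₂ (blk Lc q' β) with hK₂def
  have hK₁ : Decays K₁ (B₁ * CG) δG := fun p' q' e f => by
    simp only [hK₁def]
    rw [abs_mul, mul_assoc]
    exact mul_le_mul (hf₁ _) (hG p' q' e f) (abs_nonneg _) hB₁
  have hK₂ : Decays K₂ (B₂ * CG) δG := fun p' q' e f => by
    simp only [hK₂def]
    rw [abs_mul, mul_comm, mul_assoc]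
    exact mul_le_mul (hf₂ _) (hG p' q' e f) (abs_nonneg _) hB₂
  -- the weighted coarse-leg charges
  have hrow : ∀ (f : Fib d) (y : Site (d + 1)), HasSum (fun x' : Site (d + 1) => K₁ ((Lc : ℤ) • x') y (Sum.inr α) f)
      ((fun (f : Fib d) (y : Site (d + 1)) => Sum.elim (fun κ : Fin (d + 1) => -((stepScale d Lc j * (Lc : ℝ) ^ (d + 1))⁻¹ *
          (if κ = α ∧ y α % (Lc : ℤ) = (Lc : ℤ) - 1 then f₁ (blk Lc y α) else 0))) (fun _ => (0 : ℝ)) f) f y) := by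
    intro f y
    have e : ∀ x' : Site (d + 1), K₁ ((Lc : ℤ) • x') y (Sum.inr α) f = f₁ (x' α) * G ((Lc : ℤ) • x') y (Sum.inr α) f := fun x' => by
      simp only [hK₁def, blk_zsmul hLc]
    simp only [e]
    rcases f with κ | m'
    · exact hasSum_row_coord_inl hr j α f₁ hf₁ y κ
    · exact hasSum_row_coord_inr hr j α f₁ hf₁ y m'
  have hcol : ∀ (g : Fib d) (w : Site (d + 1)), HasSum (fun z' : Site (d + 1) => K₂ w ((Lc : ℤ) • z') g (Sum.inr β))
      ((fun (g : Fib d) (w : Site (d + 1)) => Sum.elim (fun κ : Fin (d + 1) => (stepScale d Lc j * (Lc : ℝ) ^ (d + 1))⁻¹ *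
          (if κ = β ∧ w β % (Lc : ℤ) = (Lc : ℤ) - 1 then f₂ (blk Lc w β) else 0)) (fun _ => (0 : ℝ)) g) g w) := by
    intro g w
    have e : ∀ z' : Site (d + 1), K₂ w ((Lc : ℤ) • z') g (Sum.inr β) = G w ((Lc : ℤ) • z') g (Sum.inr β) * f₂ (z' β) := fun z' => by
      simp only [hK₂def, blk_zsmul hLc]
    simp only [e]
    rcases g with κ | m'
    · exact hasSum_col_coord_inl hr j β f₂ hf₂ w κ
    · exact hasSum_col_coord_inr hr j β f₂ hf₂ w m'
  have h := hasSum_sandwich_readout_two (N := Lc) hK₁ hK₂ hδG hVb hδv α β hrow hcol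
  simp only [sum_sum_coord_kron] at h
  rw [tsum_neg, tsum_mul_left] at h
  refine h.congr_fun fun xz => ?_
  rw [hK₁def, hK₂def, comp_comp_weighted, blk_zsmul hLc, blk_zsmul hLc]

/-! ## §2 The instance for the second bond-derivative read-out `mmRead Lc (K3OfK G_j …)` -/

/-- NOT IN PRINT; OUR BOOKKEEPING.  **THE ORDER-2 TOWER STEP** (every `j`, in-block root; the letter's hypotheses `Loc (dM_b)`, `Loc (dM_{b′})`, `Loc (W_{bb′})` verbatim; bounded
`f₁ f₂ : ℤ → ℝ`): with `Y := dM_b∘G_j∘dM_{b′} + dM_{b′}∘G_j∘dM_b − W_{bb′}`,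
`HasSum ((x′,z′) ↦ f₁(x′_α)·f₂(z′_β)·mmRead Lc (K3OfK G_j Lc S M W b b′) x′ z′ (inl α)(inl β))
   (−(cH_j²·Σ'_{(y,w)} 𝟙[y_α % Lc = Lc−1 ∧ w_β % Lc = Lc−1]·f₁((blk y)_α)·f₂((blk w)_β)·Y y w (inl α)(inl β)))`
— the single-coordinate charge functions of the E-sector of `T2RecAt (j+1)` (its weight `cE₂·wV4 (j+1)` aside) are its INTERIOR read on the exit faces of the level-`j` blocks
against the block-constant pull-backs: the classes `{1, φ = 1 − Lc·[· % Lc = Lc−1], …}` of Part 1's sectors pull back to single-coordinate weights again, one level down. -/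
theorem hasSum_prod_coordWeighted_K3OfK_inl_inl (hr : r ∈ box (d + 1) Lc) (j : ℕ)
    (S M : Fin (d + 1) → (Fin (d + 1) → ℤ) → MKer (d + 1) (Fib d))
    (W : Fin (d + 1) → (Fin (d + 1) → ℤ) → Fin (d + 1) → (Fin (d + 1) → ℤ) → MKer (d + 1) (Fib d))
    (μ : Fin (d + 1)) (yb : Fin (d + 1) → ℤ) (ν : Fin (d + 1)) (yb' : Fin (d + 1) → ℤ)
    (hDμ : Loc (dM (coDressKBmAt (toSite r) Lc (KInvStep (d := d) Lc j)) Lc S M μ yb))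
    (hDν : Loc (dM (coDressKBmAt (toSite r) Lc (KInvStep (d := d) Lc j)) Lc S M ν yb'))
    (hW : Loc (W μ yb ν yb')) (α β : Fin (d + 1)) (f₁ f₂ : ℤ → ℝ) {B₁ B₂ : ℝ} (hf₁ : ∀ s, |f₁ s| ≤ B₁) (hf₂ : ∀ s, |f₂ s| ≤ B₂) :
    HasSum (fun xz : Site (d + 1) × Site (d + 1) => f₁ (xz.1 α) * f₂ (xz.2 β) *
        mmRead Lc (K3OfK (coDressKBmAt (toSite r) Lc (KInvStep (d := d) Lc j)) Lc S M W μ yb ν yb') xz.1 xz.2 (Sum.inl α) (Sum.inl β))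
      (-((stepScale d Lc j * (Lc : ℝ) ^ (d + 1))⁻¹ ^ 2 *
        ∑' yw : Site (d + 1) × Site (d + 1),
          (if yw.1 α % (Lc : ℤ) = (Lc : ℤ) - 1 ∧ yw.2 β % (Lc : ℤ) = (Lc : ℤ) - 1 then
            f₁ (blk Lc yw.1 α) * f₂ (blk Lc yw.2 β) *
              (comp (comp (dM (coDressKBmAt (toSite r) Lc (KInvStep (d := d) Lc j)) Lc S M μ yb) (coDressKBmAt (toSite r) Lc (KInvStep (d := d) Lc j)))
                    (dM (coDressKBmAt (toSite r) Lc (KInvStep (d := d) Lc j)) Lc S M ν yb') +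
                  comp (comp (dM (coDressKBmAt (toSite r) Lc (KInvStep (d := d) Lc j)) Lc S M ν yb') (coDressKBmAt (toSite r) Lc (KInvStep (d := d) Lc j)))
                    (dM (coDressKBmAt (toSite r) Lc (KInvStep (d := d) Lc j)) Lc S M μ yb) - W μ yb ν yb') yw.1 yw.2 (Sum.inl α) (Sum.inl β)
          else 0))) := by
  set G := coDressKBmAt (toSite r) Lc (KInvStep (d := d) Lc j) with hGdef
  have hG : Spr G := spr_coDressKBmAt (one_le_of_neZero Lc) hr (spr_KInvStep j)
  set Y := comp (comp (dM G Lc S M μ yb) G) (dM G Lc S M ν yb') + comp (comp (dM G Lc S M ν yb') G) (dM G Lc S M μ yb) - W μ yb ν yb' with hYdef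
  have hY : Loc Y := (((hDμ.comp_spr hG).comp hDν).add ((hDν.comp_spr hG).comp hDμ)).sub hW
  have e : K3OfK G Lc S M W μ yb ν yb' = comp (comp G Y) G := by
    rw [K3OfK_eq_sandwich hG Lc S M W μ yb ν yb' hDμ hDν hW, ← hYdef]
  refine (hasSum_prod_coordWeighted_sandwich hr j hY α β f₁ f₂ hf₁ hf₂).congr_fun fun xz => ?_
  simp only [mmRead_inl_inl, e, ← hGdef]

end Summit.QuantumFields.BalabanUV.Beta.GAN24.QuarticPushCoordCharge

end
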